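import Summits.HubbardSuperconductivity.HubbardSuperconductivity.Theorems.AnisotropyChordTransferFlipEntries

/-!
# Route `AnisotropyChord` / H0 rotor rung, route (1), hypothesis (H3) = THEOREM Z⁺: THE FLIP OPERATOR `⨂σʸ` AND THE
# FLIP-PARITY PINNING LEMMA

The abstract core of THEOREM Z⁺ (theory seat `hubbard-h0-rotor-theory-1`, THEOREM-Z.md steps (2)–(3), memo ROTOR-THEORY-11 §176):

* the flip operator `⨂_x σʸ_x` (`productOp (fun _ => spinHalfPauli 1)`): unitary, fixes every bond `S^b_x S^b_y` and hence
  `H'(J₁,J₂,J₃)` and `Sʸ_tot` (`flipOp_conj_*`); its entries join `σ` to its global flip `σ̄` with the REAL sign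
  `(−1)^{|Λ|/2 + Σ_z σ_z}` on an even number of sites (`flipOp_apply_of_even`, `flipOp_mulVec_of_even`) — constant on each parity
  class, opposite on the two classes;
* block diagonality of a parity-preserving `H` (`mulVec_parityComponent`);
* **`flipOp_mulVec_eq_sign_smul`**: on the ground vectors of a parity block the flip operator acts by the block's sign (Perron
  positivity + uniqueness on the block, `parityBlock_perronFrobenius`);
* **`exists_eigenvector_ker_of_flipParity` (THE PINNING LEMMA)**: for a stoquastic parity-preserving `H` with connected double-flip
  graph on `2m` sites, an operator `Y` commuting with `H` that changes the parity, and the flip operator commuting with both, every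
  attained lower bound `E` of the quadratic form of `H` has an eigenvector ANNIHILATED by `Y` (a non-zero parity component `w` of a
  ground vector has `⨂σʸ w = ±w`, and `Y w` lies in the other class with the opposite sign, so `Y w = 0`).

All folklore.  Prover seat `hubbard-h0-rotor-p1` g14.
-/

set_option linter.dupNamespace false
set_option autoImplicit false

noncomputable section

open Finset Matrix
open scoped ComplexOrder
open Literature.MathematicalPhysics.QuantumLattice

namespace Summit.HubbardSuperconductivity.HubbardSuperconductivity.Theorems.AnisotropyChord.Transfer

section FlipOp

open Complex Literature.MathematicalPhysics.QuantumLattice.SpinOperators Literature.Probability.LatticeModels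

variable {Λ : Type*} [Fintype Λ] [DecidableEq Λ]
variable {d : ℕ} (L : ℕ) [NeZero L]

/-- the two elements of `Fin 2` (local two-line triviality). [folklore] -/
private theorem fin2_cases (k : Fin 2) : k = 0 ∨ k = 1 := by
  fin_cases k <;> simp

/-! ### The flip operator `⨂_x σʸ_x` -/

/-- `⨂σʸ` is unitary (and an involution). [folklore] -/
theorem flipOp_mul_conjTranspose :
    productOp (fun _ : Λ => spinHalfPauli 1) * (productOp (fun _ : Λ => spinHalfPauli 1))ᴴ = 1 ∧
    (productOp (fun _ : Λ => spinHalfPauli 1))ᴴ * productOp (fun _ : Λ => spinHalfPauli 1) = 1 := by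
  have hu : ∀ _x : Λ, spinHalfPauli 1 * (spinHalfPauli 1)ᴴ = 1 := fun _ => by
    rw [pauliY_conjTranspose, pauliY_mul_pauliY]
  have hu' : ∀ _x : Λ, (spinHalfPauli 1)ᴴ * spinHalfPauli 1 = 1 := fun _ => by
    rw [pauliY_conjTranspose, pauliY_mul_pauliY]
  exact ⟨productOp_mul_conjTranspose hu, productOp_conjTranspose_mul hu'⟩

/-- **`⨂σʸ` fixes every bond `S^b_x S^b_y`** (`σʸ S^b σʸ = ±S^b` with the same sign at both ends). [folklore] -/
theorem flipOp_conj_spinBond (b : Fin 3) (x y : Λ) :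
    productOp (fun _ : Λ => spinHalfPauli 1) * spinBond 1 b x y * (productOp (fun _ : Λ => spinHalfPauli 1))ᴴ =
      spinBond 1 b x y := by
  have hu : ∀ _x : Λ, spinHalfPauli 1 * (spinHalfPauli 1)ᴴ = 1 := fun _ => by
    rw [pauliY_conjTranspose, pauliY_mul_pauliY]
  have hu' : ∀ _x : Λ, (spinHalfPauli 1)ᴴ * spinHalfPauli 1 = 1 := fun _ => by
    rw [pauliY_conjTranspose, pauliY_mul_pauliY]
  rw [productOp_conj_spinBond_of_smul (n := 1) hu hu' (f := fun _ : Λ => if b = 1 then (1 : ℂ) else -1)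
    (fun _ => pauliY_conj_spinVec b) x y]
  split_ifs <;> simp

/-- **`⨂σʸ` commutes with the spin-½ `H'(J₁,J₂,J₃)`** (π-rotation about the `y` axis). [folklore] -/
theorem flipOp_conj_xyzBondHamiltonian₃ (J₁ J₂ J₃ : ℝ) :
    productOp (fun _ : TorusSite d L => spinHalfPauli 1) * xyzBondHamiltonian₃ (d := d) L 1 J₁ J₂ J₃ *
        (productOp (fun _ : TorusSite d L => spinHalfPauli 1))ᴴ =
      xyzBondHamiltonian₃ (d := d) L 1 J₁ J₂ J₃ := by
  set U := productOp (fun _ : TorusSite d L => spinHalfPauli 1) with hU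
  rw [xyzBondHamiltonian₃, mul_neg, neg_mul, Finset.mul_sum, Finset.sum_mul]
  congr 1
  refine Finset.sum_congr rfl fun e _ => ?_
  induction e using Sym2.ind with
  | h x y =>
    rw [Sym2.lift_mk]
    show U * xyzBond₃ 1 J₁ J₂ J₃ x y * Uᴴ = xyzBond₃ 1 J₁ J₂ J₃ x y
    rw [xyzBond₃, mul_add, mul_add, add_mul, add_mul, mul_smul_comm, mul_smul_comm, mul_smul_comm,
      smul_mul_assoc, smul_mul_assoc, smul_mul_assoc, hU, flipOp_conj_spinBond, flipOp_conj_spinBond,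
      flipOp_conj_spinBond]

/-- **`⨂σʸ` commutes with `Sʸ_tot`.** [folklore] -/
theorem flipOp_conj_totalSpin_one :
    productOp (fun _ : Λ => spinHalfPauli 1) * (totalSpin 1 1 : Op Λ 2) * (productOp (fun _ : Λ => spinHalfPauli 1))ᴴ =
      totalSpin 1 1 := by
  have hu : ∀ _x : Λ, spinHalfPauli 1 * (spinHalfPauli 1)ᴴ = 1 := fun _ => by
    rw [pauliY_conjTranspose, pauliY_mul_pauliY]
  rw [totalSpin, Finset.mul_sum, Finset.sum_mul]
  refine Finset.sum_congr rfl fun x _ => ?_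
  rw [productOp_conj_siteSpin hu x 1, pauliY_conj_spinVec, if_pos rfl, one_smul, siteSpin]

omit [DecidableEq Λ] in
/-- **entries of `⨂σʸ`**: non-zero only between a configuration and its global flip, where the entry is
`(−i)^{|Λ|}·(−1)^{Σ_z σ_z}`. [folklore] -/
theorem flipOp_apply (σ τ : Λ → Fin 2) :
    productOp (fun _ : Λ => spinHalfPauli 1) σ τ =
      if τ = (fun z => 1 - σ z) then (-I) ^ Fintype.card Λ * (-1) ^ (∑ z, (σ z : ℕ)) else 0 := by
  rw [productOp_apply]
  by_cases h : τ = fun z => 1 - σ z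
  · rw [if_pos h]
    have hfac : ∀ z, spinHalfPauli 1 (σ z) (τ z) = (-I) * (-1) ^ (σ z : ℕ) := by
      intro z
      rw [h, pauliY_apply]
      rcases fin2_cases (σ z) with hz | hz <;> simp [hz]
    rw [Finset.prod_congr rfl fun z _ => hfac z, Finset.prod_mul_distrib, Finset.prod_const, Finset.card_univ,
      Finset.prod_pow_eq_pow_sum]
  · rw [if_neg h]
    obtain ⟨z, hz⟩ : ∃ z, τ z ≠ 1 - σ z := by
      by_contra hcon
      push Not at hcon
      exact h (funext hcon)
    exact Finset.prod_eq_zero (Finset.mem_univ z) (by rw [pauliY_apply, if_neg hz])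

omit [DecidableEq Λ] in
/-- entries of `⨂σʸ` on an EVEN number of sites: `[τ = σ̄]·(−1)^{|Λ|/2 + Σ_z σ_z}` — a real sign, constant on each parity
class and opposite on the two classes. [folklore] -/
theorem flipOp_apply_of_even {m : ℕ} (hm : Fintype.card Λ = 2 * m) (σ τ : Λ → Fin 2) :
    productOp (fun _ : Λ => spinHalfPauli 1) σ τ =
      if τ = (fun z => 1 - σ z) then (-1) ^ (m + ∑ z, (σ z : ℕ)) else 0 := by
  rw [flipOp_apply, hm]
  split_ifs
  · rw [pow_mul, neg_pow I 2, Complex.I_sq, pow_add]; ring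
  · rfl

/-- the action of `⨂σʸ` on vectors (even number of sites): `(⨂σʸ v)(σ) = (−1)^{m + Σσ} v(σ̄)`. [folklore] -/
theorem flipOp_mulVec_of_even {m : ℕ} (hm : Fintype.card Λ = 2 * m) (v : (Λ → Fin 2) → ℂ) (σ : Λ → Fin 2) :
    (productOp (fun _ : Λ => spinHalfPauli 1) *ᵥ v) σ = (-1) ^ (m + ∑ z, (σ z : ℕ)) * v (fun z => 1 - σ z) := by
  rw [Matrix.mulVec, dotProduct, Finset.sum_eq_single (fun z => 1 - σ z)]
  · rw [flipOp_apply_of_even hm, if_pos rfl]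
  · intro τ _ hτ
    rw [flipOp_apply_of_even hm, if_neg hτ, zero_mul]
  · intro h; exact absurd (Finset.mem_univ _) h

omit [DecidableEq Λ] in
/-- weight of the global flip: `Σ_z (1 − σ_z) + Σ_z σ_z = |Λ|`. [folklore] -/
theorem weight_flipAll_add (σ : Λ → Fin 2) :
    (∑ z, (((1 : Fin 2) - σ z : Fin 2) : ℕ)) + (∑ z, (σ z : ℕ)) = Fintype.card Λ := by
  rw [← Finset.sum_add_distrib, ← Finset.card_univ, Finset.card_eq_sum_ones]
  refine Finset.sum_congr rfl fun z _ => ?_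
  rcases fin2_cases (σ z) with hz | hz <;> simp [hz]

omit [DecidableEq Λ] in
/-- on an even number of sites the global flip preserves the parity. [folklore] -/
theorem weight_flipAll_mod_two {m : ℕ} (hm : Fintype.card Λ = 2 * m) (σ : Λ → Fin 2) :
    (∑ z, (((1 : Fin 2) - σ z : Fin 2) : ℕ)) % 2 = (∑ z, (σ z : ℕ)) % 2 := by
  have := weight_flipAll_add σ
  omega

omit [Fintype Λ] [DecidableEq Λ] in
/-- the global flip is an involution. [folklore] -/
theorem flipAll_flipAll' (σ : Λ → Fin 2) : (fun z => 1 - (1 - σ z)) = σ := by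
  funext z; rcases fin2_cases (σ z) with hz | hz <;> simp [hz]

end FlipOp

/-! ## The flip-parity pinning lemma (abstract form of THEOREM Z⁺, steps (2)–(3) of THEOREM-Z.md) -/

section Pinning

variable {Λ : Type*} [Fintype Λ] [DecidableEq Λ] (G : SimpleGraph Λ)

omit [DecidableEq Λ] in
/-- the two parity components of a vector add up to it. [folklore] -/
private theorem component_add (v : (Λ → Fin 2) → ℂ) :
    (fun σ => if (∑ z, (σ z : ℕ)) % 2 = 0 then v σ else 0) + (fun σ => if (∑ z, (σ z : ℕ)) % 2 = 1 then v σ else 0) = v := by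
  funext σ
  simp only [Pi.add_apply]
  have h : (∑ z, (σ z : ℕ)) % 2 = 0 ∨ (∑ z, (σ z : ℕ)) % 2 = 1 := Nat.mod_two_eq_zero_or_one _
  rcases h with h | h <;> simp [h]

/-- **block diagonality**: the parity components of an eigenvector of a parity-preserving `H` are eigenvectors. [folklore] -/
theorem mulVec_parityComponent (H : Op Λ 2)
    (hpar : ∀ σ τ : TensorIndex Λ 2, (∑ z, (σ z : ℕ)) % 2 ≠ (∑ z, (τ z : ℕ)) % 2 → H σ τ = 0)
    {E : ℂ} {v : (Λ → Fin 2) → ℂ} (hv : H *ᵥ v = E • v) (r : ℕ) :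
    H *ᵥ (fun σ => if (∑ z, (σ z : ℕ)) % 2 = r then v σ else 0) =
      E • (fun σ => if (∑ z, (σ z : ℕ)) % 2 = r then v σ else 0) := by
  funext σ
  rw [Pi.smul_apply, smul_eq_mul, Matrix.mulVec, dotProduct]
  by_cases hσ : (∑ z, (σ z : ℕ)) % 2 = r
  · rw [if_pos hσ]
    have h := congrFun hv σ
    rw [Pi.smul_apply, smul_eq_mul, Matrix.mulVec, dotProduct] at h
    rw [← h]
    refine Finset.sum_congr rfl fun τ _ => ?_
    by_cases hτ : (∑ z, (τ z : ℕ)) % 2 = r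
    · rw [if_pos hτ]
    · rw [if_neg hτ, hpar σ τ (by rw [hσ]; exact Ne.symm hτ), zero_mul, zero_mul]
  · rw [if_neg hσ, mul_zero]
    refine Finset.sum_eq_zero fun τ _ => ?_
    by_cases hτ : (∑ z, (τ z : ℕ)) % 2 = r
    · rw [hpar σ τ (by rw [hτ]; exact hσ), zero_mul]
    · rw [if_neg hτ, mul_zero]

/-- `(−1)^(m + w) = (−1)^(m + r)` when `w ≡ r (mod 2)`. [folklore] -/
private theorem neg_one_pow_parity {m w r : ℕ} (h : w % 2 = r) : ((-1 : ℂ) ^ (m + w)) = (-1) ^ (m + r) := by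
  rw [pow_add, pow_add, neg_one_pow_eq_pow_mod_two (R := ℂ) (n := w), h]

/-- **the flip operator acts on each parity block's ground vectors by the block's sign.**  Under the hypotheses of
`parityBlock_perronFrobenius`, if `Gt` commutes with `H` and acts by `(Gt v)(σ) = (−1)^{m + Σσ} v(σ̄)` (the operator `⨂σʸ` on
`2m` sites), then every solution of `H w = E w` supported in the parity class `r` satisfies `Gt w = (−1)^{m+r} w` (Perron
positivity pins the eigenvalue of the involution `Gt` on the one-dimensional block ground space). THEOREM-Z.md step (2). [folklore] -/
theorem flipOp_mulVec_eq_sign_smul (hG : G.Connected) {m : ℕ} (hm : Fintype.card Λ = 2 * m) (H Gt : Op Λ 2)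
    (hreal : ∀ σ τ : TensorIndex Λ 2, star (H σ τ) = H σ τ)
    (hsymm : ∀ σ τ : TensorIndex Λ 2, H σ τ = H τ σ)
    (hoff : ∀ σ τ : TensorIndex Λ 2, σ ≠ τ → (H σ τ).re ≤ 0)
    (hflip : ∀ (x y : Λ) (σ : TensorIndex Λ 2), G.Adj x y → H σ (flipAt x (flipAt y σ)) ≠ 0)
    (hHG : H * Gt = Gt * H)
    (hGt : ∀ (v : (Λ → Fin 2) → ℂ) (σ : Λ → Fin 2),
      (Gt *ᵥ v) σ = (-1) ^ (m + ∑ z, (σ z : ℕ)) * v (fun z => 1 - σ z))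
    {E : ℝ} (hE : ∀ v : TensorIndex Λ 2 → ℂ, E * (star v ⬝ᵥ v).re ≤ (star v ⬝ᵥ H *ᵥ v).re) (r : ℕ)
    {w : (Λ → Fin 2) → ℂ} (hw0 : w ≠ 0) (hw : ∀ σ, (∑ z, (σ z : ℕ)) % 2 ≠ r → w σ = 0)
    (hHw : H *ᵥ w = (E : ℂ) • w) :
    Gt *ᵥ w = ((-1 : ℂ) ^ (m + r)) • w := by
  obtain ⟨hpos, huniq⟩ := parityBlock_perronFrobenius G hG H hreal hsymm hoff hflip hE r
  obtain ⟨c, hc0, hcpos⟩ := hpos w hw0 hw hHw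
  -- the positive representative `P = c • w`
  set P : (Λ → Fin 2) → ℂ := c • w with hP
  have hPsupp : ∀ σ, (∑ z, (σ z : ℕ)) % 2 ≠ r → P σ = 0 := fun σ hσ => by
    rw [hP, Pi.smul_apply, smul_eq_mul, hw σ hσ, mul_zero]
  have hHP : H *ᵥ P = (E : ℂ) • P := by rw [hP, Matrix.mulVec_smul, hHw, smul_comm]
  have hP0 : P ≠ 0 := smul_ne_zero hc0 hw0
  -- `Gt P` is again a ground vector supported in the class
  have hGsupp : ∀ σ, (∑ z, (σ z : ℕ)) % 2 ≠ r → (Gt *ᵥ P) σ = 0 := by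
    intro σ hσ
    rw [hGt, hPsupp _ (by rw [weight_flipAll_mod_two hm]; exact hσ), mul_zero]
  have hHGP : H *ᵥ (Gt *ᵥ P) = (E : ℂ) • (Gt *ᵥ P) := by
    rw [Matrix.mulVec_mulVec, hHG, ← Matrix.mulVec_mulVec, hHP, Matrix.mulVec_smul]
  obtain ⟨lam, hlam⟩ := huniq P (Gt *ᵥ P) hPsupp hGsupp hHP hHGP hP0
  -- a configuration in the class where `P` is positive, and its flip
  obtain ⟨σ₀, hσ₀⟩ := Function.ne_iff.1 hP0
  have hr₀ : (∑ z, (σ₀ z : ℕ)) % 2 = r := by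
    by_contra h; exact hσ₀ (hPsupp σ₀ h)
  have hr₁ : (∑ z, (((1 : Fin 2) - σ₀ z : Fin 2) : ℕ)) % 2 = r := by rw [weight_flipAll_mod_two hm]; exact hr₀
  obtain ⟨hre₀, him₀⟩ := hcpos σ₀ hr₀
  obtain ⟨hre₁, him₁⟩ := hcpos (fun z => 1 - σ₀ z) hr₁
  have hPσ₀ : P σ₀ = c * w σ₀ := rfl
  have hPσ₁ : P (fun z => 1 - σ₀ z) = c * w (fun z => 1 - σ₀ z) := rfl
  -- the two equations `(Gt P)(σ₀) = ε P(σ̄₀)`, `(Gt P)(σ̄₀) = ε P(σ₀)` with the same sign `ε = (−1)^(m+r)`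
  have e₀ := congrFun hlam σ₀
  have e₁ := congrFun hlam (fun z => 1 - σ₀ z)
  rw [Pi.smul_apply, smul_eq_mul, hGt, neg_one_pow_parity hr₀] at e₀
  rw [Pi.smul_apply, smul_eq_mul, hGt, neg_one_pow_parity hr₁, flipAll_flipAll'] at e₁
  -- adding: `ε (P σ₀ + P σ̄₀) = lam (P σ₀ + P σ̄₀)` with a positive bracket
  have hsum : ((-1 : ℂ) ^ (m + r) - lam) * (P σ₀ + P (fun z => 1 - σ₀ z)) = 0 := by
    linear_combination e₀ + e₁
  have hne : P σ₀ + P (fun z => 1 - σ₀ z) ≠ 0 := by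
    intro h
    have := congrArg Complex.re h
    rw [Complex.add_re, hPσ₀, hPσ₁, Complex.zero_re] at this
    linarith
  have hlam' : lam = (-1 : ℂ) ^ (m + r) := by
    have := (mul_eq_zero.1 hsum).resolve_right hne
    exact (sub_eq_zero.1 this).symm
  -- back to `w = c⁻¹ • P`
  have hw' : w = c⁻¹ • P := by rw [hP, smul_smul, inv_mul_cancel₀ hc0, one_smul]
  rw [hw', Matrix.mulVec_smul, hlam, hlam', smul_comm]

/-- **THE FLIP-PARITY PINNING LEMMA (abstract THEOREM Z⁺, THEOREM-Z.md steps (2)–(3)).**  Let `H` be a stoquastic spin-½ matrix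
on `2m` sites (real symmetric, non-positive off-diagonal, parity preserving, non-zero on edge double flips of a connected graph),
`Y` an operator commuting with `H` that CHANGES the parity (e.g. `Sʸ_tot`), `Gt` the flip operator `⨂σʸ` (commuting with `H` and
`Y`, acting by `(−1)^{m+Σσ} v(σ̄)`), and `E` a lower bound of the quadratic form of `H` attained by an eigenvector `v₀ ≠ 0`.  Then
`H` has an eigenvector at `E` ANNIHILATED by `Y`: a non-zero parity component `w` of `v₀` has `Gt w = (−1)^{m+r} w`, while `Y w`
lies in the other class where `Gt` acts by the opposite sign; as `Gt` commutes with `Y` this forces `Y w = 0`. [folklore] -/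
theorem exists_eigenvector_ker_of_flipParity (hG : G.Connected) {m : ℕ} (hm : Fintype.card Λ = 2 * m) (H Y Gt : Op Λ 2)
    (hreal : ∀ σ τ : TensorIndex Λ 2, star (H σ τ) = H σ τ)
    (hsymm : ∀ σ τ : TensorIndex Λ 2, H σ τ = H τ σ)
    (hoff : ∀ σ τ : TensorIndex Λ 2, σ ≠ τ → (H σ τ).re ≤ 0)
    (hpar : ∀ σ τ : TensorIndex Λ 2, (∑ z, (σ z : ℕ)) % 2 ≠ (∑ z, (τ z : ℕ)) % 2 → H σ τ = 0)
    (hflip : ∀ (x y : Λ) (σ : TensorIndex Λ 2), G.Adj x y → H σ (flipAt x (flipAt y σ)) ≠ 0)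
    (hHY : H * Y = Y * H) (hHG : H * Gt = Gt * H) (hYG : Y * Gt = Gt * Y)
    (hYpar : ∀ σ τ : TensorIndex Λ 2, (∑ z, (σ z : ℕ)) % 2 = (∑ z, (τ z : ℕ)) % 2 → Y σ τ = 0)
    (hGt : ∀ (v : (Λ → Fin 2) → ℂ) (σ : Λ → Fin 2),
      (Gt *ᵥ v) σ = (-1) ^ (m + ∑ z, (σ z : ℕ)) * v (fun z => 1 - σ z))
    {E : ℝ} (hE : ∀ v : TensorIndex Λ 2 → ℂ, E * (star v ⬝ᵥ v).re ≤ (star v ⬝ᵥ H *ᵥ v).re)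
    {v₀ : (Λ → Fin 2) → ℂ} (hv₀ : v₀ ≠ 0) (hHv₀ : H *ᵥ v₀ = (E : ℂ) • v₀) :
    ∃ w : (Λ → Fin 2) → ℂ, w ≠ 0 ∧ H *ᵥ w = (E : ℂ) • w ∧ Y *ᵥ w = 0 := by
  -- a non-zero parity component of `v₀`
  obtain ⟨r, hr2, hwr⟩ : ∃ r : ℕ, r < 2 ∧ (fun σ => if (∑ z, (σ z : ℕ)) % 2 = r then v₀ σ else 0) ≠ 0 := by
    by_contra h
    push Not at h
    apply hv₀
    rw [← component_add v₀, h 0 (by norm_num), h 1 (by norm_num), add_zero]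
  set w : (Λ → Fin 2) → ℂ := fun σ => if (∑ z, (σ z : ℕ)) % 2 = r then v₀ σ else 0 with hwdef
  have hwsupp : ∀ σ, (∑ z, (σ z : ℕ)) % 2 ≠ r → w σ = 0 := fun σ hσ => by rw [hwdef]; exact if_neg hσ
  have hHw : H *ᵥ w = (E : ℂ) • w := mulVec_parityComponent H hpar hHv₀ r
  refine ⟨w, hwr, hHw, ?_⟩
  -- `Q = Y w` lies in the other class and is a ground vector
  set Q := Y *ᵥ w with hQ
  have hQsupp : ∀ σ, (∑ z, (σ z : ℕ)) % 2 ≠ 1 - r → Q σ = 0 := by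
    intro σ hσ
    have hσr : (∑ z, (σ z : ℕ)) % 2 = r := by have := Nat.mod_lt (∑ z, (σ z : ℕ)) two_pos; omega
    rw [hQ, Matrix.mulVec, dotProduct]
    refine Finset.sum_eq_zero fun τ _ => ?_
    by_cases hτ : (∑ z, (τ z : ℕ)) % 2 = r
    · rw [hYpar σ τ (by rw [hσr, hτ]), zero_mul]
    · rw [hwsupp τ hτ, mul_zero]
  have hHQ : H *ᵥ Q = (E : ℂ) • Q := by
    rw [hQ, Matrix.mulVec_mulVec, hHY, ← Matrix.mulVec_mulVec, hHw, Matrix.mulVec_smul]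
  -- the two signs
  have hGw : Gt *ᵥ w = ((-1 : ℂ) ^ (m + r)) • w :=
    flipOp_mulVec_eq_sign_smul G hG hm H Gt hreal hsymm hoff hflip hHG hGt hE r hwr hwsupp hHw
  have hGQ : Gt *ᵥ Q = ((-1 : ℂ) ^ (m + r)) • Q := by
    rw [hQ, Matrix.mulVec_mulVec, ← hYG, ← Matrix.mulVec_mulVec, hGw, Matrix.mulVec_smul]
  by_contra hQ0
  have hGQ' : Gt *ᵥ Q = ((-1 : ℂ) ^ (m + (1 - r))) • Q :=
    flipOp_mulVec_eq_sign_smul G hG hm H Gt hreal hsymm hoff hflip hHG hGt hE (1 - r) hQ0 hQsupp hHQ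
  have hsigns : ((-1 : ℂ) ^ (m + (1 - r))) = -((-1 : ℂ) ^ (m + r)) := by
    interval_cases r <;> simp [pow_succ]
  rw [hGQ, hsigns, neg_smul] at hGQ'
  -- `s • Q = −(s • Q)` with `s = ±1` forces `Q = 0`
  have h2 : (2 : ℂ) • (((-1 : ℂ) ^ (m + r)) • Q) = 0 := by
    rw [two_smul]
    nth_rewrite 2 [hGQ']
    exact add_neg_cancel _
  rw [smul_smul] at h2
  rcases smul_eq_zero.1 h2 with h | h
  · exact absurd h (mul_ne_zero two_ne_zero (pow_ne_zero _ (neg_ne_zero.2 one_ne_zero)))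
  · exact hQ0 h

end Pinning

end Summit.HubbardSuperconductivity.HubbardSuperconductivity.Theorems.AnisotropyChord.Transfer
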